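import Literature.NumberTheory.Sieve.FriableMoebiusRootSumStepPrimes
import HarnessLib

/-!
# The friable Möbius–root sum: the inductive step `k → k + 1`

Topic `Literature/NumberTheory/Sieve` (sequel to `FriableMoebiusRootSumStepPrimes.lean`; the
assembly of the induction is `FriableMoebiusRootSum.lean`). Everything here is PROVED; no
definitions, no named facts. Notation as in `…StepPrimes`: `ρ = ρ_g`, `w(n) = μ(n)ρ(n)/n`,
`G(x, y) = ∑_{d ∈ smoothNumbersUpTo ⌊x⌋ ⌈y⌉} w(d)`, `R(v) = ∑_{n ≤ v} w(n) log(v/n)`, `ω` = Buchstab's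
function, and the inductive hypothesis `P(k, C)`:
`|G(X, Y) − C_g ω(log X/log Y)/log Y − (R(X/Y) − C_g)/log Y| ≤ C/log² Y` (`2 ≤ Y ≤ X`, `log X ≤ k log Y`).

* `abs_friableSum_sub_main_step` — for `k ≥ 2`, `P(k, C)`, the boundary-layer bound
  `|R(v) − C_g| ≤ C_B/(1 + log v)²` and Mertens' second theorem along `g` with rate (constant `C_E`):
  for `e² ≤ y ≤ x` with `k log y < log x ≤ (k + 1) log y`,
  `|G(x, y) − C_g ω(u)/log y − (R(x/y) − C_g)/log y| ≤ C'/log² y`,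
  `C' = C + 2 C_B + 4((C + C_B)(1/2 + 3 C_E) + |C_g| K_main)`, `K_main = (2 + (k+3)³) C_E + 12 + 4k`.

Proof: Buchstab's identity at `z = x^{1/k}` (`FriableMoebiusRoot.friableSum_eq_sub_sum_primes`),
`P(k, C)` at `(x, z)`, the prime terms (`abs_primeSum_friableSum_sub_main_le`) and
`ω(k)/log z = k ω(k)/log x`, `ω(u)/log y = u ω(u)/log x`. This is the `ρ`-weighted analogue of the
tree's `abs_card_roughIcc_sub_main_step` (rough numbers), whose parameter bookkeeping is reused.

## References

* G. Tenenbaum, *Introduction to analytic and probabilistic number theory*, Ch. III.6. [Tenenbaum2015]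
* J. D. Lichtman, arXiv:2109.02851, Lemma 6.1 (the template induction). [Lichtman2025LinearSieve]
-/

open Finset Real Polynomial

noncomputable section

namespace Literature.NumberTheory.Sieve

namespace FriableMoebiusRoot

/-- **Assembly of the inductive step** (all elementary inequalities between the parameters
`y < z = x^{1/k}`, `a = ⌈y⌉ − 1`, `b = ⌈z⌉ − 1` supplied as hypotheses; see
`abs_friableSum_sub_main_step` for the self-contained statement). [cite: Tenenbaum2015, Ch. III.6] -/
theorem abs_friableSum_sub_main_step_of {g : ℤ[X]} {b₀ CE C CB : ℝ} (hC : 0 ≤ C) (hCB : 0 ≤ CB)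
    (hM : ∀ t : ℝ, 2 ≤ t → |∑ p ∈ Nat.primesLE ⌊t⌋₊, (polyRootCountMod ![g] p : ℝ) / p -
      (Real.log (Real.log t) + b₀)| ≤ CE / Real.log t ^ 2)
    {k : ℕ} (hk : 2 ≤ k)
    (hP : ∀ X Y : ℝ, 2 ≤ Y → Y ≤ X → Real.log X ≤ k * Real.log Y →
      |(∑ d ∈ Nat.smoothNumbersUpTo ⌊X⌋₊ ⌈Y⌉₊,
          (ArithmeticFunction.moebius d : ℝ) * (polyRootCountMod ![g] d : ℝ) / d) -
        batemanHornConst ![g] * buchstabOmega (Real.log X / Real.log Y) / Real.log Y -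
        ((∑ n ∈ Icc 1 ⌊X / Y⌋₊, (ArithmeticFunction.moebius n : ℝ) * (polyRootCountMod ![g] n : ℝ) / n *
            Real.log (X / Y / n)) - batemanHornConst ![g]) / Real.log Y| ≤ C / Real.log Y ^ 2)
    (hBL : ∀ v : ℝ, 1 ≤ v →
      |(∑ n ∈ Icc 1 ⌊v⌋₊, (ArithmeticFunction.moebius n : ℝ) * (polyRootCountMod ![g] n : ℝ) / n *
          Real.log (v / n)) - batemanHornConst ![g]| ≤ CB / (1 + Real.log v) ^ 2)
    {x y z a b : ℝ} {N M : ℕ} (hNdef : ⌈y⌉₊ = N) (hMdef : ⌈z⌉₊ = M) (hNM : N ≤ M)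
    (hS : (Finset.Ico N M).filter Nat.Prime = (Finset.Ioc ⌊a⌋₊ ⌊b⌋₊).filter Nat.Prime)
    (hx0 : 0 < x) (hy1 : 1 < y) (hly1 : 1 ≤ Real.log y)
    (hz2 : 2 ≤ z) (hzx : z ≤ x) (hzz : z * z ≤ x) (hyz : y ≤ z)
    (hz_log : Real.log z = Real.log x / k)
    (hyu : (k : ℝ) ≤ Real.log x / Real.log y) (hxy : Real.log x ≤ (k + 1) * Real.log y)
    (hea : Real.exp 1 ≤ a) (hay : a ≤ y) (hya : y ≤ a + 1) (hab : a ≤ b) (hbz : b < z)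
    (hzb : z ≤ b + 1) (hlya : Real.log y ≤ 2 * Real.log a) (hxa : Real.log x ≤ 2 * (k + 1) * Real.log a)
    (hpy : ∀ p ∈ (Finset.Ioc ⌊a⌋₊ ⌊b⌋₊).filter Nat.Prime, y ≤ (p : ℝ))
    (hpx : ∀ p ∈ (Finset.Ioc ⌊a⌋₊ ⌊b⌋₊).filter Nat.Prime, (p : ℝ) ^ 2 ≤ x)
    (hxp : ∀ p ∈ (Finset.Ioc ⌊a⌋₊ ⌊b⌋₊).filter Nat.Prime, Real.log x ≤ (k + 1) * Real.log p) :
    |(∑ d ∈ Nat.smoothNumbersUpTo ⌊x⌋₊ ⌈y⌉₊,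
        (ArithmeticFunction.moebius d : ℝ) * (polyRootCountMod ![g] d : ℝ) / d) -
      batemanHornConst ![g] * buchstabOmega (Real.log x / Real.log y) / Real.log y -
      ((∑ n ∈ Icc 1 ⌊x / y⌋₊, (ArithmeticFunction.moebius n : ℝ) * (polyRootCountMod ![g] n : ℝ) / n *
          Real.log (x / y / n)) - batemanHornConst ![g]) / Real.log y| ≤
      (C + 2 * CB + 4 * ((C + CB) * (1 / 2 + 3 * CE) +
        |batemanHornConst ![g]| * ((2 + (k + 3) ^ 3) * CE + 12 + 4 * k))) / Real.log y ^ 2 := by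
  have hk2 : (2 : ℝ) ≤ k := by exact_mod_cast hk
  have hk0 : (0 : ℝ) < k := by linarith
  have hy0 : 0 < y := by linarith
  have hly : 0 < Real.log y := by linarith
  have hz0 : 0 < z := by linarith
  have hlz : Real.log y ≤ Real.log z := Real.log_le_log hy0 hyz
  have hlz0 : 0 < Real.log z := by linarith
  have hLx : 0 < Real.log x := by
    have : 0 < Real.log x / Real.log y := hk0.trans_le hyu
    exact (div_pos_iff_of_pos_right hly).mp this
  have ha0 : 0 < a := (Real.exp_pos 1).trans_le hea
  have hla : 1 ≤ Real.log a := by rw [Real.le_log_iff_exp_le ha0]; exact hea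
  have hCE : 0 ≤ CE := mertensConst_nonneg hM
  -- Buchstab's identity
  have hBuch := friableSum_eq_sub_sum_primes g hNM ⌊x⌋₊
  rw [hNdef]
  rw [hS] at hBuch
  have hBuch' : ∑ d ∈ Nat.smoothNumbersUpTo ⌊x⌋₊ N,
      (ArithmeticFunction.moebius d : ℝ) * (polyRootCountMod ![g] d : ℝ) / d =
      (∑ d ∈ Nat.smoothNumbersUpTo ⌊x⌋₊ M,
        (ArithmeticFunction.moebius d : ℝ) * (polyRootCountMod ![g] d : ℝ) / d) +
      ∑ p ∈ (Finset.Ioc ⌊a⌋₊ ⌊b⌋₊).filter Nat.Prime, (polyRootCountMod ![g] p : ℝ) / p *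
        ∑ d ∈ Nat.smoothNumbersUpTo (⌊x⌋₊ / p) p,
          (ArithmeticFunction.moebius d : ℝ) * (polyRootCountMod ![g] d : ℝ) / d := by
    rw [hBuch]; ring
  -- `P(k, C)` at `(x, z)`
  have hPz := hP x z hz2 hzx (by rw [hz_log]; field_simp; exact le_refl _)
  have hkz : Real.log x / Real.log z = k := by rw [hz_log]; field_simp
  rw [hMdef, hkz] at hPz
  -- the prime terms
  have hprimes := abs_primeSum_friableSum_sub_main_le hC hCB hM hk hP hBL hea hay hya hab hbz hzb hx0
    hz_log hyu hxy hxa hpy hpx hxp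
  -- the two boundary-layer terms
  have hBLz : |((∑ n ∈ Icc 1 ⌊x / z⌋₊, (ArithmeticFunction.moebius n : ℝ) * (polyRootCountMod ![g] n : ℝ) / n *
      Real.log (x / z / n)) - batemanHornConst ![g]) / Real.log z| ≤ CB / Real.log y ^ 2 := by
    have hv : 1 ≤ x / z := by rw [le_div_iff₀ hz0]; linarith
    have h := hBL (x / z) hv
    have hlv : Real.log y ≤ Real.log (x / z) := by
      refine hlz.trans (Real.log_le_log hz0 ?_)
      rw [le_div_iff₀ hz0]; exact hzz
    rw [abs_div, abs_of_pos hlz0]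
    calc _ ≤ (CB / (1 + Real.log (x / z)) ^ 2) / Real.log z := div_le_div_of_nonneg_right h hlz0.le
      _ ≤ (CB / Real.log y ^ 2) / 1 :=
          div_le_div₀ (by positivity) (div_le_div_of_nonneg_left hCB (by positivity)
            (pow_le_pow_left₀ hly.le (by linarith) 2)) one_pos (by linarith)
      _ = CB / Real.log y ^ 2 := div_one _
  have hBLy : |((∑ n ∈ Icc 1 ⌊x / y⌋₊, (ArithmeticFunction.moebius n : ℝ) * (polyRootCountMod ![g] n : ℝ) / n *
      Real.log (x / y / n)) - batemanHornConst ![g]) / Real.log y| ≤ CB / Real.log y ^ 2 := by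
    have hv : 1 ≤ x / y := by rw [le_div_iff₀ hy0]; linarith
    have h := hBL (x / y) hv
    have hlv : Real.log y ≤ Real.log (x / y) := by
      rw [Real.log_div hx0.ne' hy0.ne']
      have : (k : ℝ) * Real.log y ≤ Real.log x := by rwa [le_div_iff₀ hly] at hyu
      nlinarith
    rw [abs_div, abs_of_pos hly]
    calc _ ≤ (CB / (1 + Real.log (x / y)) ^ 2) / Real.log y := div_le_div_of_nonneg_right h hly.le
      _ ≤ (CB / Real.log y ^ 2) / 1 :=
          div_le_div₀ (by positivity) (div_le_div_of_nonneg_left hCB (by positivity)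
            (pow_le_pow_left₀ hly.le (by linarith) 2)) one_pos (by linarith)
      _ = CB / Real.log y ^ 2 := div_one _
  -- `ω(k)/log z = kω(k)/L`, `ω(u)/log y = uω(u)/L`
  have hωz : batemanHornConst ![g] * buchstabOmega k / Real.log z =
      batemanHornConst ![g] * (1 / Real.log x * (k * buchstabOmega k)) := by
    rw [hz_log]; field_simp
  have hωy : batemanHornConst ![g] * buchstabOmega (Real.log x / Real.log y) / Real.log y =
      batemanHornConst ![g] * (1 / Real.log x * (Real.log x / Real.log y *
        buchstabOmega (Real.log x / Real.log y))) := by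
    field_simp
  rw [hωz] at hPz
  rw [hBuch', hωy]
  -- conversions `1/log² z ≤ 1/log² y`, `1/log² a ≤ 4/log² y`
  set K₁ := (C + CB) * (1 / 2 + 3 * CE) +
    |batemanHornConst ![g]| * ((2 + (k + 3) ^ 3) * CE + 12 + 4 * k) with hK₁
  have hK₁0 : 0 ≤ K₁ := by simp only [hK₁]; positivity
  have hCz : C / Real.log z ^ 2 ≤ C / Real.log y ^ 2 :=
    div_le_div_of_nonneg_left hC (by positivity) (pow_le_pow_left₀ hly.le hlz 2)
  have hKa : K₁ / Real.log a ^ 2 ≤ 4 * K₁ / Real.log y ^ 2 := by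
    have h4 : Real.log y ^ 2 ≤ 4 * Real.log a ^ 2 := by
      calc Real.log y ^ 2 ≤ (2 * Real.log a) ^ 2 := pow_le_pow_left₀ hly.le hlya 2
        _ = 4 * Real.log a ^ 2 := by ring
    calc K₁ / Real.log a ^ 2 = 4 * K₁ / (4 * Real.log a ^ 2) := by field_simp
      _ ≤ 4 * K₁ / Real.log y ^ 2 := div_le_div_of_nonneg_left (by positivity) (by positivity) h4
  -- assemble
  have hsplit : (C + 2 * CB + 4 * K₁) / Real.log y ^ 2 =
      C / Real.log y ^ 2 + CB / Real.log y ^ 2 + 4 * K₁ / Real.log y ^ 2 + CB / Real.log y ^ 2 := by ring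
  rw [hsplit]
  rw [abs_le] at hPz hprimes hBLz hBLy ⊢
  constructor <;> linarith [hPz.1, hPz.2, hprimes.1, hprimes.2, hBLz.1, hBLz.2, hBLy.1, hBLy.2]

/-- **The inductive step of the friable Möbius–root law (main case).** Assume `P(k, C)` (`k ≥ 2`),
the boundary-layer bound `|R(v) − C_g| ≤ C_B/(1 + log v)²` (`v ≥ 1`) and Mertens' second theorem
along `g` with rate (constant `C_E`). Then for `e² ≤ y ≤ x` with `k log y < log x ≤ (k + 1) log y`,
`|G(x, y) − C_g ω(u)/log y − (R(x/y) − C_g)/log y| ≤ (C + 2C_B + 4((C + C_B)(1/2 + 3C_E) + |C_g| K_main))/log² y`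
(Buchstab's identity at `z = x^{1/k}`). [cite: Tenenbaum2015, Ch. III.6] -/
theorem abs_friableSum_sub_main_step {g : ℤ[X]} {b₀ CE C CB : ℝ} (hC : 0 ≤ C) (hCB : 0 ≤ CB)
    (hM : ∀ t : ℝ, 2 ≤ t → |∑ p ∈ Nat.primesLE ⌊t⌋₊, (polyRootCountMod ![g] p : ℝ) / p -
      (Real.log (Real.log t) + b₀)| ≤ CE / Real.log t ^ 2)
    {k : ℕ} (hk : 2 ≤ k)
    (hP : ∀ X Y : ℝ, 2 ≤ Y → Y ≤ X → Real.log X ≤ k * Real.log Y →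
      |(∑ d ∈ Nat.smoothNumbersUpTo ⌊X⌋₊ ⌈Y⌉₊,
          (ArithmeticFunction.moebius d : ℝ) * (polyRootCountMod ![g] d : ℝ) / d) -
        batemanHornConst ![g] * buchstabOmega (Real.log X / Real.log Y) / Real.log Y -
        ((∑ n ∈ Icc 1 ⌊X / Y⌋₊, (ArithmeticFunction.moebius n : ℝ) * (polyRootCountMod ![g] n : ℝ) / n *
            Real.log (X / Y / n)) - batemanHornConst ![g]) / Real.log Y| ≤ C / Real.log Y ^ 2)
    (hBL : ∀ v : ℝ, 1 ≤ v →
      |(∑ n ∈ Icc 1 ⌊v⌋₊, (ArithmeticFunction.moebius n : ℝ) * (polyRootCountMod ![g] n : ℝ) / n *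
          Real.log (v / n)) - batemanHornConst ![g]| ≤ CB / (1 + Real.log v) ^ 2)
    {x y : ℝ} (hy : Real.exp 2 ≤ y) (hyx : y ≤ x) (hkxy : k * Real.log y < Real.log x)
    (hxy : Real.log x ≤ (k + 1) * Real.log y) :
    |(∑ d ∈ Nat.smoothNumbersUpTo ⌊x⌋₊ ⌈y⌉₊,
        (ArithmeticFunction.moebius d : ℝ) * (polyRootCountMod ![g] d : ℝ) / d) -
      batemanHornConst ![g] * buchstabOmega (Real.log x / Real.log y) / Real.log y -
      ((∑ n ∈ Icc 1 ⌊x / y⌋₊, (ArithmeticFunction.moebius n : ℝ) * (polyRootCountMod ![g] n : ℝ) / n *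
          Real.log (x / y / n)) - batemanHornConst ![g]) / Real.log y| ≤
      (C + 2 * CB + 4 * ((C + CB) * (1 / 2 + 3 * CE) +
        |batemanHornConst ![g]| * ((2 + (k + 3) ^ 3) * CE + 12 + 4 * k))) / Real.log y ^ 2 := by
  -- numerics about `y`, `x` (the bookkeeping of the tree's `abs_card_roughIcc_sub_main_step`)
  have hk2 : (2 : ℝ) ≤ k := by exact_mod_cast hk
  have hk0 : (0 : ℝ) < k := by linarith
  have he1 : (2 : ℝ) ≤ Real.exp 1 := by have := Real.add_one_le_exp (1 : ℝ); linarith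
  have he2 : Real.exp 1 ≤ Real.exp 2 - 1 := by
    have h2 : Real.exp 2 = Real.exp 1 * Real.exp 1 := by rw [← Real.exp_add]; norm_num
    nlinarith
  have hy0 : 0 < y := (Real.exp_pos 2).trans_le hy
  have hy1 : 1 < y := by linarith
  have hly2 : 2 ≤ Real.log y := by rw [Real.le_log_iff_exp_le hy0]; exact hy
  have hly : 0 < Real.log y := by linarith
  have hLx : 0 < Real.log x := by
    have : (k : ℝ) * Real.log y ≥ 2 * 2 := mul_le_mul hk2 hly2 (by norm_num) hk0.le
    linarith
  have hx1 : 1 < x := by linarith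
  have hx0 : 0 < x := by linarith
  have hyu : (k : ℝ) ≤ Real.log x / Real.log y := by rw [le_div_iff₀ hly]; exact hkxy.le
  -- `z = x^{1/k}`
  set z : ℝ := Real.exp (Real.log x / k) with hz_def
  have hz0 : 0 < z := Real.exp_pos _
  have hz_log : Real.log z = Real.log x / k := Real.log_exp _
  have hyz : y < z := by
    have h : Real.log y < Real.log x / k := by rw [lt_div_iff₀ hk0]; linarith
    calc y = Real.exp (Real.log y) := (Real.exp_log hy0).symm
      _ < z := Real.exp_lt_exp.mpr h
  have hzz : z * z ≤ x := by
    have h : Real.log x / k + Real.log x / k ≤ Real.log x := by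
      rw [← two_mul, ← mul_div_assoc, div_le_iff₀ hk0]
      have : Real.log x * 2 ≤ Real.log x * k := mul_le_mul_of_nonneg_left hk2 hLx.le
      linarith
    calc z * z = Real.exp (Real.log x / k + Real.log x / k) := by rw [Real.exp_add]
      _ ≤ Real.exp (Real.log x) := Real.exp_le_exp.mpr h
      _ = x := Real.exp_log hx0
  have hz1 : 1 ≤ z := by linarith
  have hzx : z ≤ x := le_trans (le_mul_of_one_le_left hz0.le hz1) hzz
  have hz2 : (2 : ℝ) ≤ z := by linarith
  -- `N = ⌈y⌉`, `M = ⌈z⌉`, `a = N − 1`, `b = M − 1`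
  set N := ⌈y⌉₊ with hN
  set M := ⌈z⌉₊ with hM'
  have hN1 : 0 < N := Nat.ceil_pos.mpr hy0
  have hM1 : 0 < M := Nat.ceil_pos.mpr hz0
  have hNM : N ≤ M := Nat.ceil_le_ceil hyz.le
  set a : ℝ := ((N - 1 : ℕ) : ℝ) with ha_def
  set b : ℝ := ((M - 1 : ℕ) : ℝ) with hb_def
  have haN : a = (N : ℝ) - 1 := by rw [ha_def, Nat.cast_sub hN1, Nat.cast_one]
  have hbM : b = (M : ℝ) - 1 := by rw [hb_def, Nat.cast_sub hM1, Nat.cast_one]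
  have hyN : y ≤ N := Nat.le_ceil y
  have hNy : (N : ℝ) < y + 1 := Nat.ceil_lt_add_one hy0.le
  have hzM : z ≤ M := Nat.le_ceil z
  have hMz : (M : ℝ) < z + 1 := Nat.ceil_lt_add_one hz0.le
  have hay : a ≤ y := by rw [haN]; linarith
  have hya : y ≤ a + 1 := by rw [haN]; linarith
  have hbz : b < z := by rw [hbM]; linarith
  have hzb : z ≤ b + 1 := by rw [hbM]; linarith
  have hab : a ≤ b := by
    rw [haN, hbM]
    have : (N : ℝ) ≤ M := by exact_mod_cast hNM
    linarith
  have hea : Real.exp 1 ≤ a := by linarith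
  have ha0 : 0 < a := (Real.exp_pos 1).trans_le hea
  have hasq : y ≤ a ^ 2 := by
    have h1 : y - 1 ≤ a := by linarith
    have h2 : (y - 1) ^ 2 ≤ a ^ 2 := pow_le_pow_left₀ (by linarith) h1 2
    have h3 : y ≤ (y - 1) ^ 2 := by nlinarith
    exact h3.trans h2
  have hlya : Real.log y ≤ 2 * Real.log a := by
    calc Real.log y ≤ Real.log (a ^ 2) := Real.log_le_log hy0 hasq
      _ = 2 * Real.log a := by rw [Real.log_pow]; norm_num
  have hxa : Real.log x ≤ 2 * (k + 1) * Real.log a := by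
    calc Real.log x ≤ (k + 1) * Real.log y := hxy
      _ ≤ (k + 1) * (2 * Real.log a) := by gcongr
      _ = 2 * (k + 1) * Real.log a := by ring
  -- the index set of primes `y ≤ p < z`
  have hfloor_a : ⌊a⌋₊ = N - 1 := by rw [ha_def, Nat.floor_natCast]
  have hfloor_b : ⌊b⌋₊ = M - 1 := by rw [hb_def, Nat.floor_natCast]
  have hS : (Finset.Ico N M).filter Nat.Prime = (Finset.Ioc ⌊a⌋₊ ⌊b⌋₊).filter Nat.Prime := by
    rw [hfloor_a, hfloor_b]
    congr 1
    ext p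
    simp only [Finset.mem_Ico, Finset.mem_Ioc]
    omega
  have hpS : ∀ p ∈ (Finset.Ioc ⌊a⌋₊ ⌊b⌋₊).filter Nat.Prime, y ≤ (p : ℝ) ∧ (p : ℝ) ≤ b := by
    intro p hp
    rw [Finset.mem_filter, Finset.mem_Ioc, hfloor_a, hfloor_b] at hp
    obtain ⟨⟨h1, h2⟩, -⟩ := hp
    refine ⟨?_, ?_⟩
    · have : N ≤ p := by omega
      calc y ≤ N := hyN
        _ ≤ p := by exact_mod_cast this
    · rw [hbM]
      have : p + 1 ≤ M := by omega
      have : (p : ℝ) + 1 ≤ M := by exact_mod_cast this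
      linarith
  have hpy : ∀ p ∈ (Finset.Ioc ⌊a⌋₊ ⌊b⌋₊).filter Nat.Prime, y ≤ (p : ℝ) := fun p hp => (hpS p hp).1
  have hpx : ∀ p ∈ (Finset.Ioc ⌊a⌋₊ ⌊b⌋₊).filter Nat.Prime, (p : ℝ) ^ 2 ≤ x := fun p hp => by
    obtain ⟨-, h2⟩ := hpS p hp
    have hpz : (p : ℝ) ≤ z := h2.trans hbz.le
    have hp0 : (0 : ℝ) ≤ p := Nat.cast_nonneg p
    rw [sq]
    exact le_trans (mul_le_mul hpz hpz hp0 hz0.le) hzz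
  have hxp : ∀ p ∈ (Finset.Ioc ⌊a⌋₊ ⌊b⌋₊).filter Nat.Prime, Real.log x ≤ (k + 1) * Real.log p :=
    fun p hp => by
    obtain ⟨h1, -⟩ := hpS p hp
    calc Real.log x ≤ (k + 1) * Real.log y := hxy
      _ ≤ (k + 1) * Real.log p := by gcongr
  exact abs_friableSum_sub_main_step_of hC hCB hM hk hP hBL hN.symm hM'.symm hNM hS hx0 hy1 (by linarith)
    hz2 hzx hzz hyz.le hz_log hyu hxy hea hay hya hab hbz hzb hlya hxa hpy hpx hxp

end FriableMoebiusRoot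

end Literature.NumberTheory.Sieve
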